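/-
Copyright (c) 2026. All rights reserved.
Released under Apache 2.0 license as described in the file LICENSE.
-/
import Literature.Geometry.Lorentzian.IMCFMeanCurvatureEvolution
import Literature.Geometry.Riemannian.GaussBonnet
import HarnessLib

/-!
# Geroch monotonicity of the Hawking mass under smooth inverse mean curvature flow — discharged

`Literature.Geometry.Lorentzian.geroch_monotonicity_smooth`
(`Literature/Geometry/Lorentzian/InverseMeanCurvatureFlow.lean`) is the named fact stating
Huisken–Ilmanen 2001, §5, Monotonicity Calculation (after Geroch 1973 and Jang–Wald 1977): *under a
classical inverse mean curvature flow of closed connected surfaces in a `3`-manifold of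
nonnegative scalar curvature, the Hawking mass is monotone nondecreasing.* All analytic steps of
the printed computation are theorems of the tree, assembled in
`geroch_monotonicity_smooth_of_gaussBonnet` (`IMCFMeanCurvatureEvolution.lean`), whose only
hypothesis is the Gauss–Bonnet input "`∫_{N_t} 2K = 4πχ(N_t) ≤ 8π` provided that `N_t` is
connected" for the induced metrics of the leaves. That input is now the theorem
`Literature.Geometry.Riemannian.integral_scalarCurvature_ofRiemannian_le`
(`Literature/Geometry/Riemannian/GaussBonnet.lean`, the Gauss–Bonnet theorem proved by the
Poincaré–Hopf route), so the fact is discharged: `geroch_monotonicity_smooth_holds`.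

## References

* G. Huisken, T. Ilmanen, *The inverse mean curvature flow and the Riemannian Penrose
  inequality*, J. Differential Geom. 59 (2001) 353–437, §5, Monotonicity Calculation
  (pp. 394–395). [HuiskenIlmanenIMCF2001]
* R. Geroch, *Energy extraction*, Ann. New York Acad. Sci. 224 (1973) 108–117.
* J. M. Lee, *Introduction to Riemannian Manifolds* (2018), Thm. 9.7 (Gauss–Bonnet).
-/

noncomputable section

open Bundle Set MeasureTheory
open scoped Manifold ContDiff Topology Real

namespace Literature.Geometry.Lorentzian

open PseudoRiemannianMetric

/-- **Geroch monotonicity under smooth inverse mean curvature flow** (Huisken–Ilmanen 2001, §5,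
Monotonicity Calculation, pp. 394–395): discharge of the named fact
`geroch_monotonicity_smooth`, by `geroch_monotonicity_smooth_of_gaussBonnet` and the Gauss–Bonnet
bound `∫ S dA ≤ 8π` for the (compact, connected) leaves
(`Literature.Geometry.Riemannian.integral_scalarCurvature_ofRiemannian_le`).
[cite: HuiskenIlmanenIMCF2001, §5, Monotonicity Calculation (pp. 394–395)] -/
theorem geroch_monotonicity_smooth_holds : geroch_monotonicity_smooth :=
  geroch_monotonicity_smooth_of_gaussBonnet
    fun _X _ _ _ _ _ h _ _S _ _ _ _ _ _ _ _ hpb F _ν _a _b Hc t ht ↦ by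
      haveI : (ofRiemannian ((ofRiemannian h).inducedRiemannianMetric (F t) hpb
          (Hc.isSpacelikeImmersion t ht))).HasLeviCivita :=
        ((ofRiemannian h).inducedMetric (F t) hpb (Hc.isSpacelikeImmersion t ht)).hasLeviCivita
      exact Literature.Geometry.Riemannian.integral_scalarCurvature_ofRiemannian_le
        ((ofRiemannian h).inducedRiemannianMetric (F t) hpb (Hc.isSpacelikeImmersion t ht))

end Literature.Geometry.Lorentzian

end
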